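import Literature.NumberTheory.DiophantineGeometry.MahlerMeasureSeveral
import Mathlib.Analysis.Complex.ExponentialBounds
import HarnessLib

/-!
# Gelfond's lemma on the coefficients of a product of complex polynomials (Bombieri–Gubler Lemma 1.6.11)

Topic `Literature/NumberTheory/DiophantineGeometry`. **Gelfond's lemma** (Bombieri–Gubler,
*Heights in Diophantine Geometry*, Lemma 1.6.11): if `f = f₁ ⋯ f_m` are complex polynomials in
`n` variables and `d` is the sum of the partial degrees of `f`, then
`2^{−d} ∏ ℓ∞(f_j) ≤ ℓ∞(f) ≤ 2^d ∏ ℓ∞(f_j)`, `ℓ∞` the maximum modulus of the coefficients.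

We prove the LOWER bound (the non-trivial direction) from the Mahler measure in several variables
(`MahlerMeasureSeveral.lean`: multiplicativity, `M ≤ ℓ₁`, and Lemma 1.6.10), in the following
definition-free form with the slightly weaker constant that the `ℓ₁`-route gives (B–G obtain `2^d`
through `M ≤ ℓ₂` and Parseval; `e^d` is what the applications in the tree need):

* `gelfond_lower` — for non-zero `f_j` and any chosen non-zero coefficients `a_j` of the `f_j`
  there is a coefficient `a` of `∏ f_j` with
  `∑_j log |a_j| ≤ log |a| + ∑_v [log C(S_v, ⌊S_v/2⌋) + log (S_v + 1)]`,
  where `S_v = ∑_j deg_{x_v} f_j` (the partial degree of the product in `x_v`);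
* `gelfond_lower_linear` — the same with the constant `∑_v S_v` (`C(d, ⌊d/2⌋)(d + 1) ≤ e^d`,
  `choose_middle_mul_succ_le_exp`), i.e. `∏_j ℓ∞(f_j) ≤ e^{d} ℓ∞(∏ f_j)`.

Auxiliary: the Vandermonde inequality `∏ C(d_j, a_j) ≤ C(∑ d_j, ∑ a_j)` (Lemma 1.6.12, first
half) and the count `#supp f ≤ ∏_v (deg_{x_v} f + 1)`. Everything is proved; no named facts.

## References

* [BombieriGubler2006] E. Bombieri, W. Gubler, *Heights in Diophantine Geometry*, CUP 2006, §1.6,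
  Lemma 1.6.10, Lemma 1.6.11 (Gelfond's lemma), Lemma 1.6.12 (p. 27–28).
-/

noncomputable section

open MeasureTheory MvPolynomial Real Set Filter

namespace Literature.NumberTheory.DiophantineGeometry

variable {n : ℕ}

/-! ### Combinatorial lemmas -/

/-- `C(m, i) C(k, j) ≤ C(m + k, i + j)` (one term of Vandermonde's identity).
[cite: BombieriGubler2006, §1.6, Lemma 1.6.12] -/
theorem choose_mul_choose_le_choose_add (m k i j : ℕ) :
    m.choose i * k.choose j ≤ (m + k).choose (i + j) := by
  rw [Nat.add_choose_eq]
  exact Finset.single_le_sum (f := fun ij : ℕ × ℕ => m.choose ij.1 * k.choose ij.2)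
    (fun _ _ => Nat.zero_le _) (a := (i, j)) (Finset.mem_antidiagonal.mpr rfl)

/-- **Vandermonde's inequality** `∏ⱼ C(dⱼ, aⱼ) ≤ C(∑ dⱼ, ∑ aⱼ)`.
[cite: BombieriGubler2006, §1.6, Lemma 1.6.12] -/
theorem prod_choose_le_choose_sum {ι : Type*} (s : Finset ι) (d a : ι → ℕ) :
    ∏ j ∈ s, (d j).choose (a j) ≤ (∑ j ∈ s, d j).choose (∑ j ∈ s, a j) := by
  classical
  induction s using Finset.induction_on with
  | empty => simp
  | insert b s hb ih =>
    rw [Finset.prod_insert hb, Finset.sum_insert hb, Finset.sum_insert hb]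
    exact (Nat.mul_le_mul_left _ ih).trans (choose_mul_choose_le_choose_add _ _ _ _)

/-- A polynomial with partial degrees `d_v` has at most `∏_v (d_v + 1)` monomials. [folklore] -/
theorem card_support_le_prod_degreeOf_succ (f : MvPolynomial (Fin n) ℂ) :
    f.support.card ≤ ∏ v, (degreeOf v f + 1) := by
  classical
  have h : f.support.card ≤
      (Fintype.piFinset fun v : Fin n => Finset.range (degreeOf v f + 1)).card := by
    refine Finset.card_le_card_of_injOn (fun e v => e v) (fun e he => ?_) ?_
    · rw [Finset.mem_coe, Fintype.mem_piFinset]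
      intro v
      exact Finset.mem_range.mpr (Nat.lt_succ_of_le (monomial_le_degreeOf v he))
    · intro e₁ _ e₂ _ h
      exact Finsupp.ext fun v => congrFun h v
  rw [Fintype.card_piFinset] at h
  simpa using h

/-- `C(d + 1, ⌊(d+1)/2⌋) ≤ 2 C(d, ⌊d/2⌋)` (Pascal's rule and maximality of the middle binomial
coefficient). [folklore] -/
theorem choose_succ_middle_le (d : ℕ) : (d + 1).choose ((d + 1) / 2) ≤ 2 * d.choose (d / 2) := by
  rcases Nat.eq_zero_or_pos d with rfl | hd
  · decide
  have h : (d + 1) / 2 = (d - 1) / 2 + 1 := by omega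
  rw [h, Nat.choose_succ_succ, two_mul]
  exact Nat.add_le_add (Nat.choose_le_middle _ _) (Nat.choose_le_middle _ _)

/-- **`C(d, ⌊d/2⌋) (d + 1) ≤ e^d`**, the numerical inequality turning the constant of the
`ℓ₁`-route of Gelfond's lemma into `e^{(sum of partial degrees)}`. [folklore] -/
theorem choose_middle_mul_succ_le_exp (d : ℕ) :
    ((d.choose (d / 2) : ℕ) : ℝ) * (d + 1) ≤ exp d := by
  have he : (2.7182818283 : ℝ) < exp 1 := Real.exp_one_gt_d9
  induction d with
  | zero => simp
  | succ d ih =>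
    rcases Nat.lt_or_ge d 2 with hd | hd
    · interval_cases d
      · -- `d + 1 = 1`: `C(1, 0) · 2 = 2 ≤ e`
        norm_num
        linarith
      · -- `d + 1 = 2`: `C(2, 1) · 3 = 6 ≤ e²`
        norm_num
        have : exp (2 : ℝ) = exp 1 * exp 1 := by rw [← Real.exp_add]; norm_num
        rw [this]
        nlinarith
    · have h1 : (((d + 1).choose ((d + 1) / 2) : ℕ) : ℝ) ≤ 2 * (d.choose (d / 2) : ℕ) := by
        exact_mod_cast choose_succ_middle_le d
      have hC : (0 : ℝ) ≤ (d.choose (d / 2) : ℕ) := Nat.cast_nonneg _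
      have hd2 : (2 : ℝ) ≤ d := by exact_mod_cast hd
      have hexp : exp ((d + 1 : ℕ) : ℝ) = exp d * exp 1 := by
        rw [← Real.exp_add]; push_cast; ring_nf
      rw [hexp]
      push_cast
      have hE : (0 : ℝ) ≤ exp d := (exp_pos _).le
      -- `C(d+1,·)(d+2) ≤ 2 C (d+2) ≤ 2.7 C (d+1) ≤ 2.7 e^d ≤ e · e^d`
      nlinarith [mul_le_mul_of_nonneg_right h1 (by positivity : (0 : ℝ) ≤ (d : ℝ) + 1 + 1),
        mul_le_mul_of_nonneg_left ih (by norm_num : (0 : ℝ) ≤ 2.7182818283)]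

/-- Logarithmic form: `log C(d, ⌊d/2⌋) + log (d + 1) ≤ d`. [folklore] -/
theorem log_choose_middle_add_log_succ_le (d : ℕ) :
    log ((d.choose (d / 2) : ℕ) : ℝ) + log ((d : ℝ) + 1) ≤ d := by
  have hC : (0 : ℝ) < (d.choose (d / 2) : ℕ) := by exact_mod_cast Nat.choose_pos (Nat.div_le_self _ _)
  have hd : (0 : ℝ) < (d : ℝ) + 1 := by positivity
  rw [← Real.log_mul hC.ne' hd.ne', Real.log_le_iff_le_exp (mul_pos hC hd)]
  exact choose_middle_mul_succ_le_exp d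

/-! ### Gelfond's lemma, lower bound -/

/-- **Gelfond's lemma, lower bound** (Bombieri–Gubler Lemma 1.6.11, left inequality, via the
`ℓ₁`-route). Let `f_j ∈ ℂ[x₀, …, x_{n−1}]` (`j ∈ s`) be non-zero and let `a_j = coeff (e j) (f j)`
be chosen non-zero coefficients. Then some coefficient `a` of `∏ f_j` satisfies
`∑_j log |a_j| ≤ log |a| + ∑_v [log C(S_v, ⌊S_v/2⌋) + log (S_v + 1)]`, `S_v = ∑_j deg_{x_v} f_j`.
Proof: `log |a_j| ≤ log M(f_j) + ∑_v log C(deg_v f_j, e_j v)` (Lemma 1.6.10); sum over `j`,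
use `M(∏ f_j) = ∏ M(f_j) ≤ ℓ₁(∏ f_j) ≤ #supp · max |coeff|`, `#supp ≤ ∏ (S_v + 1)`, and
Vandermonde `∏_j C(deg_v f_j, ·) ≤ C(S_v, ·) ≤ C(S_v, ⌊S_v/2⌋)`.
[cite: BombieriGubler2006, §1.6, Lemma 1.6.11 (p. 27)] -/
theorem gelfond_lower {ι : Type*} (s : Finset ι) (f : ι → MvPolynomial (Fin n) ℂ)
    (hf : ∀ j ∈ s, f j ≠ 0) (e : ι → (Fin n →₀ ℕ)) (he : ∀ j ∈ s, coeff (e j) (f j) ≠ 0) :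
    ∃ e' ∈ (∏ j ∈ s, f j).support,
      ∑ j ∈ s, log ‖coeff (e j) (f j)‖ ≤ log ‖coeff e' (∏ j ∈ s, f j)‖ +
        ∑ v, (log (((∑ j ∈ s, degreeOf v (f j)).choose ((∑ j ∈ s, degreeOf v (f j)) / 2) : ℕ) : ℝ) +
          log ((∑ j ∈ s, degreeOf v (f j) : ℝ) + 1)) := by
  classical
  set F := ∏ j ∈ s, f j with hF
  have hF0 : F ≠ 0 := Finset.prod_ne_zero_iff.mpr hf
  -- a largest coefficient `a = coeff e' F` of the product
  have hne : F.support.Nonempty := by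
    rw [Finset.nonempty_iff_ne_empty, Ne, support_eq_empty]
    exact hF0
  obtain ⟨e', he', hmax⟩ := Finset.exists_max_image F.support (fun d => ‖coeff d F‖) hne
  refine ⟨e', he', ?_⟩
  have ha : 0 < ‖coeff e' F‖ := norm_pos_iff.mpr (mem_support_iff.mp he')
  -- (i) Lemma 1.6.10 for each factor and multiplicativity
  have h1 : ∑ j ∈ s, log ‖coeff (e j) (f j)‖ ≤
      logMahler F + ∑ j ∈ s, ∑ v, log (((degreeOf v (f j)).choose (e j v) : ℕ) : ℝ) := by
    rw [hF, logMahler_prod s f hf, ← Finset.sum_add_distrib]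
    exact Finset.sum_le_sum fun j hj => log_norm_coeff_le_logMahler_add (f j) (e j) (he j hj)
  -- (ii) `log M(F) ≤ log ℓ₁(F) ≤ log (#supp F) + log |a|`
  have h2 : logMahler F ≤ log (F.support.card : ℝ) + log ‖coeff e' F‖ := by
    refine (logMahler_le_log_sum_norm_coeff hF0).trans ?_
    rw [← Real.log_mul (by exact_mod_cast hne.card_pos.ne') ha.ne']
    refine Real.log_le_log (sum_norm_coeff_pos hF0) ?_
    have h := Finset.sum_le_card_nsmul F.support (fun d => ‖coeff d F‖) _ hmax
    simpa using h
  -- (iii) `#supp F ≤ ∏ (S_v + 1)`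
  have h3 : log (F.support.card : ℝ) ≤ ∑ v, log ((∑ j ∈ s, degreeOf v (f j) : ℝ) + 1) := by
    have hle : (F.support.card : ℝ) ≤ ∏ v, ((∑ j ∈ s, degreeOf v (f j) : ℝ) + 1) := by
      have h := card_support_le_prod_degreeOf_succ F
      have h' : ∏ v, (degreeOf v F + 1) ≤ ∏ v : Fin n, (∑ j ∈ s, degreeOf v (f j) + 1) :=
        Finset.prod_le_prod' fun v _ => Nat.succ_le_succ (hF ▸ degreeOf_prod_le v s f)
      exact_mod_cast h.trans h'
    rw [← Real.log_prod (s := Finset.univ) (fun v _ => by positivity)]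
    exact Real.log_le_log (by exact_mod_cast hne.card_pos) hle
  -- (iv) Vandermonde and the middle binomial coefficient, variable by variable
  have h4 : ∑ j ∈ s, ∑ v, log (((degreeOf v (f j)).choose (e j v) : ℕ) : ℝ) ≤
      ∑ v, log (((∑ j ∈ s, degreeOf v (f j)).choose ((∑ j ∈ s, degreeOf v (f j)) / 2) : ℕ) : ℝ) := by
    rw [Finset.sum_comm]
    refine Finset.sum_le_sum fun v _ => ?_
    have hpos : ∀ j ∈ s, (0 : ℝ) < ((degreeOf v (f j)).choose (e j v) : ℕ) := fun j hj => by
      exact_mod_cast Nat.choose_pos (monomial_le_degreeOf v (mem_support_iff.mpr (he j hj)))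
    rw [← Real.log_prod (fun j hj => (hpos j hj).ne')]
    refine Real.log_le_log (Finset.prod_pos hpos) ?_
    have h := (prod_choose_le_choose_sum s (fun j => degreeOf v (f j)) (fun j => e j v)).trans
      (Nat.choose_le_middle _ _)
    exact_mod_cast h
  rw [Finset.sum_add_distrib]
  linarith

/-- **Gelfond's lemma, lower bound, linear constant**: with the notation of `gelfond_lower`,
`∑_j log |a_j| ≤ log |a| + ∑_v S_v`, i.e. `∏_j ℓ∞(f_j) ≤ e^{∑_v S_v} ℓ∞(∏_j f_j)` where
`∑_v S_v` is the sum over the variables of the (sums of the) partial degrees.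
[cite: BombieriGubler2006, §1.6, Lemma 1.6.11 (p. 27)] -/
theorem gelfond_lower_linear {ι : Type*} (s : Finset ι) (f : ι → MvPolynomial (Fin n) ℂ)
    (hf : ∀ j ∈ s, f j ≠ 0) (e : ι → (Fin n →₀ ℕ)) (he : ∀ j ∈ s, coeff (e j) (f j) ≠ 0) :
    ∃ e' ∈ (∏ j ∈ s, f j).support,
      ∑ j ∈ s, log ‖coeff (e j) (f j)‖ ≤
        log ‖coeff e' (∏ j ∈ s, f j)‖ + ∑ v, (∑ j ∈ s, degreeOf v (f j) : ℝ) := by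
  obtain ⟨e', he', h⟩ := gelfond_lower s f hf e he
  refine ⟨e', he', h.trans ?_⟩
  gcongr with v
  exact_mod_cast log_choose_middle_add_log_succ_le (∑ j ∈ s, degreeOf v (f j))

/-! ### Arbitrary finite sets of variables -/

/-- **Gelfond's lemma, lower bound** for polynomials in an arbitrary finite set `σ` of variables
(transport of `gelfond_lower_linear` along a bijection `σ ≃ Fin N` by renaming variables, which
preserves coefficients, products and partial degrees): for non-zero `f_j` and chosen non-zero
coefficients `a_j` there is a coefficient `a` of `∏ f_j` with
`∑_j log |a_j| ≤ log |a| + ∑_{v ∈ σ} ∑_j deg_{x_v} f_j`.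
[cite: BombieriGubler2006, §1.6, Lemma 1.6.11 (p. 27)] -/
theorem gelfond_lower_linear_fintype {σ ι : Type*} [Fintype σ] [DecidableEq σ] (s : Finset ι)
    (f : ι → MvPolynomial σ ℂ) (hf : ∀ j ∈ s, f j ≠ 0) (e : ι → (σ →₀ ℕ))
    (he : ∀ j ∈ s, coeff (e j) (f j) ≠ 0) :
    ∃ e' ∈ (∏ j ∈ s, f j).support,
      ∑ j ∈ s, log ‖coeff (e j) (f j)‖ ≤
        log ‖coeff e' (∏ j ∈ s, f j)‖ + ∑ v, (∑ j ∈ s, degreeOf v (f j) : ℝ) := by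
  classical
  set N := Fintype.card σ
  set q : σ ≃ Fin N := Fintype.equivFin σ
  have hq : Function.Injective q := q.injective
  -- transport the data
  set f' : ι → MvPolynomial (Fin N) ℂ := fun j => rename q (f j) with hf'
  have hf'0 : ∀ j ∈ s, f' j ≠ 0 := fun j hj h =>
    hf j hj ((rename_injective q hq) (by rw [map_zero]; exact h))
  have he' : ∀ j ∈ s, coeff (Finsupp.mapDomain q (e j)) (f' j) ≠ 0 := fun j hj => by
    rw [hf', coeff_rename_mapDomain q hq]
    exact he j hj
  obtain ⟨d', hd', hle⟩ := gelfond_lower_linear s f' hf'0 (fun j => Finsupp.mapDomain q (e j)) he'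
  -- the product is the renamed product; pull the exponent back
  have hprod : ∏ j ∈ s, f' j = rename q (∏ j ∈ s, f j) := by rw [hf', map_prod]
  rw [hprod, support_rename_of_injective hq, Finset.mem_image] at hd'
  obtain ⟨d, hd, rfl⟩ := hd'
  refine ⟨d, hd, ?_⟩
  rw [hprod, coeff_rename_mapDomain q hq] at hle
  simp_rw [hf', coeff_rename_mapDomain q hq] at hle
  refine hle.trans (le_of_eq ?_)
  congr 1
  -- reindex the sum over the variables
  rw [← q.symm.sum_comp]
  refine Finset.sum_congr rfl fun v _ => ?_
  refine Finset.sum_congr rfl fun j _ => ?_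
  rw [show degreeOf v (rename q (f j)) = degreeOf (q (q.symm v)) (rename q (f j)) by
    rw [q.apply_symm_apply], degreeOf_rename_of_injective hq]

end Literature.NumberTheory.DiophantineGeometry

end
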